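import Summits.CriticalPhenomena.PercolationContinuityZ3.Theorems.Transplant.FKConnectivityAllQPat3ShapeTwo
import Summits.CriticalPhenomena.PercolationContinuityZ3.Theorems.Transplant.FKConnectivityAllQPat3ShapeOneKCone
import HarnessLib

/-!
# Connectivity correlation inequalities for `φ_{w,q}`, every `q > 0` — TWO-PIECE SHAPES WITH CONTRACTED SKELETON EDGES
# (the `t = 2` engine of census g40 on the minors that contract plain slots; product cone) — census g41

Definitions + theorems file (`--supports stmt-CriticalPhenomena-4575`), census lineage (gen 41) of LANE 2's FK sub-programme; builds on
p205010 (kernel theorem, internal audit signed; external expert review pending).  No named facts, no sorries; standard axioms.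

Census g41 (memo HOME/FROM-census-g41-T2K-KSTATES.md): the (E, C)-minor form of THEOREM SP(W₄-free) needs every `K₄`-skeleton leaf in
all `{free, contracted}` states of its plain slots; this is census g40's `…Pat3ShapeTwo` (the `t = 2` leaf VEE\*) with a list `K` of
CONTRACTED skeleton edges folded (all bits true, both members) after the free colouring, exactly as `…Pat3ShapeOneK` does for `t = 1`:
* `FK.side2K`, `FK.shape2XK`, **`FK.coefTab2K`**, `FK.certCheck2S_specK`;
* **`FK.lev2C_shape2K`**: `lev2C (plainSet p L ∪ E₁ ∪ E₂) (plainSet p K ∪ C₁ ∪ C₂)` = `pairSumC` of `FK.shape2XK` at top level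
  `μ + |L| + 2|K| + 2|V|` (two `FK.sum_attachPatCC` peels, then `FK.sum_plainListK_empty`);
* **`FK.shape2KC_nonneg_of_rows` / `FK.shape2KC_nonneg_of_cert`** — the `t = 2` product cone in all K-states (census g41's kit
  j242142: all 16 states × 4 targets of VEE\* feasible with exact certificates).  `K = []` is census g40 verbatim.
[cite: AyyerLinussonRavichandran2025, §7 (p. 22)] [cite: Grimmett2006, §1.4 eq. (1.20) (p. 15)]
-/

namespace Summit.CriticalPhenomena.PercolationContinuityZ3.Theorems

namespace FK

open SimpleGraph Literature.Probability.LatticeModels Literature.Probability.Percolation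
open scoped Classical

variable {V : Type*}

section ShapeTwoK

variable [Fintype V] {ι : Type*} [DecidableEq ι]

/-- One colour side of a two-piece shape with contracted skeleton edges: free fold, contracted fold, then pieces `1, 2` attached;
final matrix + corrections. [folklore] -/
def side2K (L K : List (ι × ι)) (i1 j1 k1 i2 j2 k2 : ι) (bs : List Bool) (P1 P2 : Pat3) : (ι → ι → Bool) × ℕ :=
  ((attachPat (attachPat (foldBits (foldBits (idMat ι) (zipBits L bs)).1 (trueBits K)).1 i1 j1 k1 P1) i2 j2 k2 P2),
    (foldBits (idMat ι) (zipBits L bs)).2 + (foldBits (foldBits (idMat ι) (zipBits L bs)).1 (trueBits K)).2 +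
      (if (foldBits (foldBits (idMat ι) (zipBits L bs)).1 (trueBits K)).1 i1 j1 && P1.xy then 1 else 0) +
      (if (attachPat (foldBits (foldBits (idMat ι) (zipBits L bs)).1 (trueBits K)).1 i1 j1 k1 P1) i2 j2 && P2.xy then 1 else 0))

/-- **The target-side term of a two-piece shape with contracted skeleton edges** (`pairSumC` format, top level `N = μ + |L| + 2|K| + 2|V|`). [folklore] -/
def shape2XK (L K : List (ι × ι)) (i1 j1 k1 i2 j2 k2 ix iy is : ι) (F : ℕ → Pat3 → Pat3 → ℤ) (N : ℕ) :
    ℕ → ℕ → Pat3 → Pat3 → Pat3 → Pat3 → ℤ :=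
  fun e1 e2 P1 Q1 P2 Q2 => sumBits L.length fun bs =>
    (if e1 + e2 + ((side2K L K i1 j1 k1 i2 j2 k2 bs P1 P2).2 + (side2K L K i1 j1 k1 i2 j2 k2 (bs.map (! ·)) Q1 Q2).2) = N then
        F 0 (rdPat ix iy is (side2K L K i1 j1 k1 i2 j2 k2 bs P1 P2).1) (rdPat ix iy is (side2K L K i1 j1 k1 i2 j2 k2 (bs.map (! ·)) Q1 Q2).1)
      else 0) +
      (if e1 + e2 + ((side2K L K i1 j1 k1 i2 j2 k2 bs P1 P2).2 + (side2K L K i1 j1 k1 i2 j2 k2 (bs.map (! ·)) Q1 Q2).2) + 1 = N then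
        F 1 (rdPat ix iy is (side2K L K i1 j1 k1 i2 j2 k2 bs P1 P2).1) (rdPat ix iy is (side2K L K i1 j1 k1 i2 j2 k2 (bs.map (! ·)) Q1 Q2).1)
      else 0)

/-- The coefficient table of a two-piece shape with contracted skeleton edges at residual level `d`. Computable. [folklore] -/
def coefTab2K (L K : List (ι × ι)) (i1 j1 k1 i2 j2 k2 ix iy is : ι) (F : ℕ → Pat3 → Pat3 → ℤ) (d : ℕ) (P1 Q1 P2 Q2 : Pat3) : ℤ :=
  sumBits L.length fun bs =>
    (if (side2K L K i1 j1 k1 i2 j2 k2 bs P1 P2).2 + (side2K L K i1 j1 k1 i2 j2 k2 (bs.map (! ·)) Q1 Q2).2 = d then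
        F 0 (rdPat ix iy is (side2K L K i1 j1 k1 i2 j2 k2 bs P1 P2).1) (rdPat ix iy is (side2K L K i1 j1 k1 i2 j2 k2 (bs.map (! ·)) Q1 Q2).1)
      else 0) +
      (if (side2K L K i1 j1 k1 i2 j2 k2 bs P1 P2).2 + (side2K L K i1 j1 k1 i2 j2 k2 (bs.map (! ·)) Q1 Q2).2 + 1 = d then
        F 1 (rdPat ix iy is (side2K L K i1 j1 k1 i2 j2 k2 bs P1 P2).1) (rdPat ix iy is (side2K L K i1 j1 k1 i2 j2 k2 (bs.map (! ·)) Q1 Q2).1)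
      else 0)

omit [Fintype V] in
/-- With no contracted edges the K-side is census g40's side (`foldBits R [] = (R, 0)`). [folklore] -/
theorem side2K_nil (L : List (ι × ι)) (i1 j1 k1 i2 j2 k2 : ι) (bs : List Bool) (P1 P2 : Pat3) :
    side2K L [] i1 j1 k1 i2 j2 k2 bs P1 P2 = side2 L i1 j1 k1 i2 j2 k2 bs P1 P2 := by
  unfold side2K side2 trueBits
  simp only [List.map_nil, foldBits, Nat.add_zero]

omit [Fintype V] in
/-- **With no contracted edges the K-coefficient table is census g40's** — so census g40's all-free data files serve the state `K = []`. [folklore] -/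
theorem coefTab2K_nil (L : List (ι × ι)) (i1 j1 k1 i2 j2 k2 ix iy is : ι) (F : ℕ → Pat3 → Pat3 → ℤ) :
    coefTab2K L [] i1 j1 k1 i2 j2 k2 ix iy is F = coefTab2 L i1 j1 k1 i2 j2 k2 ix iy is F := by
  funext d P1 Q1 P2 Q2
  unfold coefTab2K coefTab2
  simp only [side2K_nil]

omit [Fintype V] in
/-- The target-side term at matching levels is the coefficient table. [folklore] -/
theorem shape2XK_eq_coefTab2K (L K : List (ι × ι)) (i1 j1 k1 i2 j2 k2 ix iy is : ι) (F : ℕ → Pat3 → Pat3 → ℤ)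
    {N e1 e2 d : ℕ} (hd : e1 + e2 + d = N) (P1 Q1 P2 Q2 : Pat3) :
    shape2XK L K i1 j1 k1 i2 j2 k2 ix iy is F N e1 e2 P1 Q1 P2 Q2 = coefTab2K L K i1 j1 k1 i2 j2 k2 ix iy is F d P1 Q1 P2 Q2 := by
  unfold shape2XK coefTab2K
  congr 1
  funext bs
  exact lev_pair_congr (by omega) _ _

omit [Fintype V] in
/-- Below the pieces' own levels the target-side term vanishes. [folklore] -/
theorem shape2XK_eq_zero (L K : List (ι × ι)) (i1 j1 k1 i2 j2 k2 ix iy is : ι) (F : ℕ → Pat3 → Pat3 → ℤ)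
    {N e1 e2 : ℕ} (h : N < e1 + e2) (P1 Q1 P2 Q2 : Pat3) :
    shape2XK L K i1 j1 k1 i2 j2 k2 ix iy is F N e1 e2 P1 Q1 P2 Q2 = 0 := by
  unfold shape2XK
  refine sumBits_eq_zero' L.length fun bs => ?_
  have e1' : ¬ (e1 + e2 + ((side2K L K i1 j1 k1 i2 j2 k2 bs P1 P2).2 + (side2K L K i1 j1 k1 i2 j2 k2 (bs.map (! ·)) Q1 Q2).2) = N) := by
    omega
  have e2' : ¬ (e1 + e2 + ((side2K L K i1 j1 k1 i2 j2 k2 bs P1 P2).2 + (side2K L K i1 j1 k1 i2 j2 k2 (bs.map (! ·)) Q1 Q2).2) + 1 = N) := by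
    omega
  rw [if_neg e1', if_neg e2', add_zero]

omit [Fintype V] in
/-- The corrections of one side number at most `|L| + |K| + 2`. [folklore] -/
theorem side2K_snd_le (L K : List (ι × ι)) (i1 j1 k1 i2 j2 k2 : ι) (bs : List Bool) (P1 P2 : Pat3) :
    (side2K L K i1 j1 k1 i2 j2 k2 bs P1 P2).2 ≤ L.length + K.length + 2 := by
  unfold side2K
  have h := (foldBits_snd_le (idMat ι) (zipBits L bs)).trans (length_zipBits_le L bs)
  have h' := (foldBits_snd_le (foldBits (idMat ι) (zipBits L bs)).1 (trueBits K)).trans (length_trueBits K).le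
  split_ifs <;> simp only <;> omega

omit [Fintype V] in
/-- The coefficient table vanishes above the structural bound `2|L| + 2|K| + 5`. [folklore] -/
theorem coefTab2K_eq_zero (L K : List (ι × ι)) (i1 j1 k1 i2 j2 k2 ix iy is : ι) (F : ℕ → Pat3 → Pat3 → ℤ) {d : ℕ}
    (hd : 2 * L.length + 2 * K.length + 5 < d) (P1 Q1 P2 Q2 : Pat3) : coefTab2K L K i1 j1 k1 i2 j2 k2 ix iy is F d P1 Q1 P2 Q2 = 0 := by
  unfold coefTab2K
  refine sumBits_eq_zero' L.length fun bs => ?_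
  have h1 := side2K_snd_le L K i1 j1 k1 i2 j2 k2 bs P1 P2
  have h2 := side2K_snd_le L K i1 j1 k1 i2 j2 k2 (bs.map (! ·)) Q1 Q2
  have e1' : ¬ ((side2K L K i1 j1 k1 i2 j2 k2 bs P1 P2).2 + (side2K L K i1 j1 k1 i2 j2 k2 (bs.map (! ·)) Q1 Q2).2 = d) := by omega
  have e2' : ¬ ((side2K L K i1 j1 k1 i2 j2 k2 bs P1 P2).2 + (side2K L K i1 j1 k1 i2 j2 k2 (bs.map (! ·)) Q1 Q2).2 + 1 = d) := by omega
  rw [if_neg e1', if_neg e2', add_zero]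

omit [Fintype V] in
/-- Unpacking a passed two-piece certificate check against `FK.coefTab2K` (all levels). [folklore] -/
theorem certCheck2S_specK {L K : List (ι × ι)} {i1 j1 k1 i2 j2 k2 ix iy is : ι} {F : ℕ → Pat3 → Pat3 → ℤ}
    {prods : List Prod2} {Dn B : ℕ} (hB : 2 * L.length + 2 * K.length + 2 ≤ B)
    (h : certCheck2S (coefTab2K L K i1 j1 k1 i2 j2 k2 ix iy is F) prods Dn B = true) (d : ℕ) (P1 Q1 P2 Q2 : Pat3) :
    4 * (prods.map fun q => (q.lam : ℤ) * q.tensor d P1 Q1 P2 Q2).sum ≤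
      (Dn : ℤ) * symm4d (coefTab2K L K i1 j1 k1 i2 j2 k2 ix iy is F) d P1 Q1 P2 Q2 := by
  unfold certCheck2S at h
  rw [Bool.and_eq_true] at h
  obtain ⟨hshift, hmain⟩ := h
  simp only [List.all_eq_true, decide_eq_true_eq] at hshift hmain
  by_cases hd : d < B + 4
  · exact hmain d (List.mem_range.2 hd) P1 P1.mem_list Q1 Q1.mem_list P2 P2.mem_list Q2 Q2.mem_list
  · rw [not_lt] at hd
    have hz : ∀ A1 A2 A3 A4 : Pat3, coefTab2K L K i1 j1 k1 i2 j2 k2 ix iy is F d A1 A2 A3 A4 = 0 :=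
      fun _ _ _ _ => coefTab2K_eq_zero L K i1 j1 k1 i2 j2 k2 ix iy is F (by omega) _ _ _ _
    simp only [symm4d, hz, add_zero, mul_zero]
    refine le_of_eq ?_
    rw [List.sum_eq_zero fun x hx => ?_, mul_zero]
    rw [List.mem_map] at hx
    obtain ⟨q, hq, rfl⟩ := hx
    rw [Prod2.tensor_eq_zero_of_le q (hshift q hq) hd, mul_zero]

variable {p : ι → V} {L K : List (ι × ι)} {E₁ C₁ E₂ C₂ : Finset (Sym2 V)} {V₁ V₂ : Set V}
  {u₁ v₁ m₁ u₂ v₂ m₂ x y s : V} {i1 j1 k1 i2 j2 k2 ix iy is : ι}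

/-- **THE TWO-LEVEL VALUE OF A TWO-PIECE SHAPE WITH CONTRACTED SKELETON EDGES AS A PAIR SUM**: skeleton `L` (free) and `K`
(contracted) on injective names, two marked piece minors glued at `(i_b, j_b)` with mark names `k_b`:
`lev2C (plainSet p L ∪ E₁ ∪ E₂) (plainSet p K ∪ C₁ ∪ C₂)` is the `pairSumC` of `FK.shape2XK` at top level `μ + |L| + 2|K| + 2|V|`. [folklore] -/
theorem lev2C_shape2K (hinj : Function.Injective p)
    (hE1 : ∀ e ∈ (↑(E₁ ∪ C₁) : Set (Sym2 V)), ∀ z ∈ e, z ∈ V₁) (hE2 : ∀ e ∈ (↑(E₂ ∪ C₂) : Set (Sym2 V)), ∀ z ∈ e, z ∈ V₂)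
    (hp1 : ∀ a, p a ∈ V₁ → p a = u₁ ∨ p a = v₁ ∨ p a = m₁) (hp2 : ∀ a, p a ∈ V₂ → p a = u₂ ∨ p a = v₂ ∨ p a = m₂)
    (h12 : ∀ z ∈ V₁, z ∈ V₂ → z = u₂ ∨ z = v₂) (hm1 : m₁ ∈ V₁) (hm2 : m₂ ∈ V₂) (huv1 : u₁ ≠ v₁) (huv2 : u₂ ≠ v₂)
    (hi1 : p i1 = u₁) (hj1 : p j1 = v₁) (hk1 : p k1 = m₁) (hi2 : p i2 = u₂) (hj2 : p j2 = v₂) (hk2 : p k2 = m₂)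
    (hk1' : k1 ≠ i1 ∧ k1 ≠ j1) (hk2' : k2 ≠ i2 ∧ k2 ≠ j2) (hx : p ix = x) (hy : p iy = y) (hs : p is = s)
    (hL : ∀ e ∈ L, p e.1 ≠ p e.2) (hnd : (L.map (pedge p)).Nodup)
    (hLm : ∀ e ∈ L, (p e.1 ≠ m₁ ∧ p e.2 ≠ m₁) ∧ (p e.1 ≠ m₂ ∧ p e.2 ≠ m₂))
    (hKm : ∀ e ∈ K, (p e.1 ≠ m₁ ∧ p e.2 ≠ m₁) ∧ (p e.1 ≠ m₂ ∧ p e.2 ≠ m₂))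
    (hd1 : Disjoint (plainSet p L) E₁) (hd2 : Disjoint (plainSet p L ∪ E₁) E₂) (F : ℕ → Pat3 → Pat3 → ℤ) (μ : ℕ) :
    lev2C (plainSet p L ∪ E₁ ∪ E₂) (plainSet p K ∪ C₁ ∪ C₂) x y s F μ =
      pairSumC E₁ C₁ E₂ C₂ u₁ v₁ m₁ u₂ v₂ m₂
        (shape2XK L K i1 j1 k1 i2 j2 k2 ix iy is F (μ + L.length + 2 * K.length + 2 * Fintype.card V)) := by
  have hmu1 : m₁ ≠ u₁ := by rw [← hk1, ← hi1]; exact fun h => hk1'.1 (hinj h)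
  have hmv1 : m₁ ≠ v₁ := by rw [← hk1, ← hj1]; exact fun h => hk1'.2 (hinj h)
  have hmu2 : m₂ ≠ u₂ := by rw [← hk2, ← hi2]; exact fun h => hk2'.1 (hinj h)
  have hmv2 : m₂ ≠ v₂ := by rw [← hk2, ← hj2]; exact fun h => hk2'.2 (hinj h)
  have hmH1 : m₁ ∉ ({z | z ∈ V₁ → z = u₁ ∨ z = v₁} : Set V) := fun h => (h hm1).elim hmu1 hmv1
  have hmH2 : m₂ ∉ ({z | z ∈ V₂ → z = u₂ ∨ z = v₂} : Set V) := fun h => (h hm2).elim hmu2 hmv2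
  have hS1 : ({z | z ∈ V₁ → z = u₁ ∨ z = v₁} : Set V) ∩ V₁ ⊆ {u₁, v₁} := fun z hz => hz.1 hz.2
  have hS2 : ({z | z ∈ V₂ → z = u₂ ∨ z = v₂} : Set V) ∩ V₂ ⊆ {u₂, v₂} := fun z hz => hz.1 hz.2
  -- the skeleton (free and contracted) lives off both pieces' interiors
  have hPL1 : ∀ e ∈ (↑(plainSet p L ∪ plainSet p K) : Set (Sym2 V)), ∀ z ∈ e, z ∈ ({z | z ∈ V₁ → z = u₁ ∨ z = v₁} : Set V) := by
    intro e he z hz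
    rw [Finset.coe_union] at he
    rcases he with he | he
    · exact plainSet_verts hp1 (fun f hf => (hLm f hf).1) e he z hz
    · exact plainSet_verts hp1 (fun f hf => (hKm f hf).1) e he z hz
  have hPL2 : ∀ e ∈ (↑(plainSet p L ∪ plainSet p K) : Set (Sym2 V)), ∀ z ∈ e, z ∈ ({z | z ∈ V₂ → z = u₂ ∨ z = v₂} : Set V) := by
    intro e he z hz
    rw [Finset.coe_union] at he
    rcases he with he | he
    · exact plainSet_verts hp2 (fun f hf => (hLm f hf).2) e he z hz
    · exact plainSet_verts hp2 (fun f hf => (hKm f hf).2) e he z hz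
  have hH2 : ∀ e ∈ (↑(plainSet p L ∪ E₁ ∪ (plainSet p K ∪ C₁)) : Set (Sym2 V)), ∀ z ∈ e,
      z ∈ ({z | z ∈ V₂ → z = u₂ ∨ z = v₂} : Set V) := by
    intro e he z hz
    simp only [Finset.coe_union, Set.mem_union] at he
    rcases he with (he | he) | (he | he)
    · exact hPL2 e (by rw [Finset.coe_union]; exact Or.inl he) z hz
    · exact fun hzV => h12 z (hE1 e (by rw [Finset.coe_union]; exact Or.inl he) z hz) hzV
    · exact hPL2 e (by rw [Finset.coe_union]; exact Or.inr he) z hz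
    · exact fun hzV => h12 z (hE1 e (by rw [Finset.coe_union]; exact Or.inr he) z hz) hzV
  set g : ℕ → (ι → ι → Bool) → (ι → ι → Bool) → ℤ := fun n A B =>
    (if n = μ + 4 * Fintype.card V + L.length + 2 * K.length then F 0 (rdPat ix iy is A) (rdPat ix iy is B) else 0) +
      (if n + 1 = μ + 4 * Fintype.card V + L.length + 2 * K.length then F 1 (rdPat ix iy is A) (rdPat ix iy is B) else 0) with hg
  have eC : plainSet p K ∪ C₁ ∪ C₂ = (plainSet p K ∪ C₁) ∪ C₂ := rfl
  unfold lev2C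
  rw [Finset.sum_congr rfl fun γ _ => show
      ((if apExpC (plainSet p L ∪ E₁ ∪ E₂) (plainSet p K ∪ C₁ ∪ C₂) γ = μ then
          F 0 (pat3 (γ ∪ (plainSet p K ∪ C₁ ∪ C₂)) x y s) (pat3 ((plainSet p L ∪ E₁ ∪ E₂) \ γ ∪ (plainSet p K ∪ C₁ ∪ C₂)) x y s)
        else 0) +
        (if apExpC (plainSet p L ∪ E₁ ∪ E₂) (plainSet p K ∪ C₁ ∪ C₂) γ + 1 = μ then
          F 1 (pat3 (γ ∪ (plainSet p K ∪ C₁ ∪ C₂)) x y s) (pat3 ((plainSet p L ∪ E₁ ∪ E₂) \ γ ∪ (plainSet p K ∪ C₁ ∪ C₂)) x y s)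
        else 0)) =
      g (apExpC (plainSet p L ∪ E₁ ∪ E₂) ((plainSet p K ∪ C₁) ∪ C₂) γ + 2 * Fintype.card V +
          (2 * Fintype.card V + L.length + 2 * K.length))
        (cmat p (γ ∪ ((plainSet p K ∪ C₁) ∪ C₂))) (cmat p ((plainSet p L ∪ E₁ ∪ E₂) \ γ ∪ ((plainSet p K ∪ C₁) ∪ C₂))) by
    simp only [hg, rdPat, ← pat3_eq_ofBits_cmat p _ hx hy hs]
    exact lev_pair_congr (by omega) _ _]
  -- peel piece 2 (host = skeleton ∪ piece 1, contracted `plainSet p K ∪ C₁`)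
  rw [sum_attachPatCC hd2 hH2 hE2 hS2 huv2 hmH2 hmu2 hmv2 hp2 hi2 hj2 hk2 (2 * Fintype.card V + L.length + 2 * K.length) g,
    Finset.sum_comm]
  -- peel piece 1 inside (host = skeleton, contracted `plainSet p K`)
  have peel1 := fun (γ₂ : Finset (Sym2 V)) =>
    sum_attachPatCC (C₁ := plainSet p K) hd1 hPL1 hE1 hS1 huv1 hmH1 hmu1 hmv1 hp1 hi1 hj1 hk1 (L.length + 2 * K.length + apExpC E₂ C₂ γ₂)
      (fun n A B => g (n + (if A i2 j2 && (pat3 (γ₂ ∪ C₂) u₂ v₂ m₂).xy then 1 else 0) +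
          (if B i2 j2 && (pat3 (E₂ \ γ₂ ∪ C₂) u₂ v₂ m₂).xy then 1 else 0))
        (attachPat A i2 j2 k2 (pat3 (γ₂ ∪ C₂) u₂ v₂ m₂)) (attachPat B i2 j2 k2 (pat3 (E₂ \ γ₂ ∪ C₂) u₂ v₂ m₂)))
  rw [Finset.sum_congr rfl fun γ₂ _ => ((Finset.sum_congr rfl fun γ' _ => by congr 1; omega).trans
    ((peel1 γ₂).trans Finset.sum_comm))]
  -- the skeleton, free and contracted, down to the edgeless host
  have peel0 := fun (γ₂ γ₁ : Finset (Sym2 V)) =>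
    sum_plainListK_empty hinj L K hL hnd (apExpC E₂ C₂ γ₂ + apExpC E₁ C₁ γ₁)
      (fun n A B => g (n +
          (if (attachPat A i1 j1 k1 (pat3 (γ₁ ∪ C₁) u₁ v₁ m₁)) i2 j2 && (pat3 (γ₂ ∪ C₂) u₂ v₂ m₂).xy then 1 else 0) +
          (if (attachPat B i1 j1 k1 (pat3 (E₁ \ γ₁ ∪ C₁) u₁ v₁ m₁)) i2 j2 && (pat3 (E₂ \ γ₂ ∪ C₂) u₂ v₂ m₂).xy then 1 else 0) +
          (if A i1 j1 && (pat3 (γ₁ ∪ C₁) u₁ v₁ m₁).xy then 1 else 0) +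
          (if B i1 j1 && (pat3 (E₁ \ γ₁ ∪ C₁) u₁ v₁ m₁).xy then 1 else 0))
        (attachPat (attachPat A i1 j1 k1 (pat3 (γ₁ ∪ C₁) u₁ v₁ m₁)) i2 j2 k2 (pat3 (γ₂ ∪ C₂) u₂ v₂ m₂))
        (attachPat (attachPat B i1 j1 k1 (pat3 (E₁ \ γ₁ ∪ C₁) u₁ v₁ m₁)) i2 j2 k2 (pat3 (E₂ \ γ₂ ∪ C₂) u₂ v₂ m₂)))
  rw [Finset.sum_congr rfl fun γ₂ _ => Finset.sum_congr rfl fun γ₁ _ =>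
    ((Finset.sum_congr rfl fun γ₀ _ => by congr 1; omega).trans (peel0 γ₂ γ₁))]
  -- reorder and match
  unfold pairSumC shape2XK
  rw [Finset.sum_comm]
  refine Finset.sum_congr rfl fun γ₁ _ => Finset.sum_congr rfl fun γ₂ _ => ?_
  congr 1
  funext bs
  simp only [hg, side2K]
  exact lev_pair_congr (by omega) _ _

/-- **THE PRODUCT-CONE THEOREM FOR TWO-PIECE SHAPES WITH CONTRACTED SKELETON EDGES, rowwise form.** [cite: AyyerLinussonRavichandran2025, §7 (p. 22)] -/
theorem shape2KC_nonneg_of_rows (hinj : Function.Injective p)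
    (hE1 : ∀ e ∈ (↑(E₁ ∪ C₁) : Set (Sym2 V)), ∀ z ∈ e, z ∈ V₁) (hE2 : ∀ e ∈ (↑(E₂ ∪ C₂) : Set (Sym2 V)), ∀ z ∈ e, z ∈ V₂)
    (hp1 : ∀ a, p a ∈ V₁ → p a = u₁ ∨ p a = v₁ ∨ p a = m₁) (hp2 : ∀ a, p a ∈ V₂ → p a = u₂ ∨ p a = v₂ ∨ p a = m₂)
    (h12 : ∀ z ∈ V₁, z ∈ V₂ → z = u₂ ∨ z = v₂) (hm1 : m₁ ∈ V₁) (hm2 : m₂ ∈ V₂) (huv1 : u₁ ≠ v₁) (huv2 : u₂ ≠ v₂)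
    (hi1 : p i1 = u₁) (hj1 : p j1 = v₁) (hk1 : p k1 = m₁) (hi2 : p i2 = u₂) (hj2 : p j2 = v₂) (hk2 : p k2 = m₂)
    (hk1' : k1 ≠ i1 ∧ k1 ≠ j1) (hk2' : k2 ≠ i2 ∧ k2 ≠ j2) (hx : p ix = x) (hy : p iy = y) (hs : p is = s)
    (hL : ∀ e ∈ L, p e.1 ≠ p e.2) (hnd : (L.map (pedge p)).Nodup)
    (hLm : ∀ e ∈ L, (p e.1 ≠ m₁ ∧ p e.2 ≠ m₁) ∧ (p e.1 ≠ m₂ ∧ p e.2 ≠ m₂))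
    (hKm : ∀ e ∈ K, (p e.1 ≠ m₁ ∧ p e.2 ≠ m₁) ∧ (p e.1 ≠ m₂ ∧ p e.2 ≠ m₂))
    (hd1 : Disjoint (plainSet p L) E₁) (hd2 : Disjoint (plainSet p L ∪ E₁) E₂) (F : ℕ → Pat3 → Pat3 → ℤ)
    {prods : List Prod2} {Dn : ℕ} (hDn : 0 < Dn)
    (hrow : ∀ d P1 Q1 P2 Q2, 4 * (prods.map fun q => (q.lam : ℤ) * q.tensor d P1 Q1 P2 Q2).sum ≤
      (Dn : ℤ) * symm4d (coefTab2K L K i1 j1 k1 i2 j2 k2 ix iy is F) d P1 Q1 P2 Q2)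
    (hval : ∀ q ∈ prods, ∀ ν : ℕ, 0 ≤ lev2C E₁ C₁ u₁ v₁ m₁ q.g1 ν ∧ 0 ≤ lev2C E₂ C₂ u₂ v₂ m₂ q.g2 ν) (μ : ℕ) :
    0 ≤ lev2C (plainSet p L ∪ E₁ ∪ E₂) (plainSet p K ∪ C₁ ∪ C₂) x y s F μ := by
  set N := μ + L.length + 2 * K.length + 2 * Fintype.card V with hN
  have e1 := lev2C_shape2K hinj hE1 hE2 hp1 hp2 h12 hm1 hm2 huv1 huv2 hi1 hj1 hk1 hi2 hj2 hk2 hk1' hk2' hx hy hs hL hnd hLm hKm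
    hd1 hd2 F μ
  have e4 : 4 * ((Dn : ℤ) * lev2C (plainSet p L ∪ E₁ ∪ E₂) (plainSet p K ∪ C₁ ∪ C₂) x y s F μ) =
      (Dn : ℤ) * pairSumC E₁ C₁ E₂ C₂ u₁ v₁ m₁ u₂ v₂ m₂ (symm4 (shape2XK L K i1 j1 k1 i2 j2 k2 ix iy is F N)) := by
    rw [e1, ← pairSumC_symm4]; ring
  have step2 : ∀ e1 e2 P1 Q1 P2 Q2,
      4 * ∑ j : Fin prods.length, ((prods.get j).lam : ℤ) * bterm2 (prods.get j) N e1 e2 P1 Q1 P2 Q2 ≤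
        (Dn : ℤ) * symm4 (shape2XK L K i1 j1 k1 i2 j2 k2 ix iy is F N) e1 e2 P1 Q1 P2 Q2 := by
    intro e1 e2 P1 Q1 P2 Q2
    by_cases hle : e1 + e2 ≤ N
    · obtain ⟨d, hd⟩ := Nat.exists_eq_add_of_le hle
      have hd' : e1 + e2 + d = N := hd.symm
      have hx' : symm4 (shape2XK L K i1 j1 k1 i2 j2 k2 ix iy is F N) e1 e2 P1 Q1 P2 Q2 =
          symm4d (coefTab2K L K i1 j1 k1 i2 j2 k2 ix iy is F) d P1 Q1 P2 Q2 := by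
        simp only [symm4, symm4d, shape2XK_eq_coefTab2K L K i1 j1 k1 i2 j2 k2 ix iy is F hd']
      rw [hx', Finset.sum_congr rfl fun j _ => by rw [bterm2_eq_tensor (prods.get j) hd'],
        ← list_sum_eq_finset_sum2 prods (fun q => (q.lam : ℤ) * q.tensor d P1 Q1 P2 Q2)]
      exact hrow d P1 Q1 P2 Q2
    · rw [not_le] at hle
      have hx' : symm4 (shape2XK L K i1 j1 k1 i2 j2 k2 ix iy is F N) e1 e2 P1 Q1 P2 Q2 = 0 := by
        simp only [symm4, shape2XK_eq_zero L K i1 j1 k1 i2 j2 k2 ix iy is F hle, add_zero]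
      rw [hx', mul_zero, Finset.sum_eq_zero fun j _ => by rw [bterm2_eq_zero (prods.get j) hle, mul_zero], mul_zero]
  have main : 0 ≤ 4 * ((Dn : ℤ) * lev2C (plainSet p L ∪ E₁ ∪ E₂) (plainSet p K ∪ C₁ ∪ C₂) x y s F μ) := by
    rw [e4, ← pairSumC_const_mul]
    refine le_trans ?_ (pairSumC_mono E₁ C₁ E₂ C₂ u₁ v₁ m₁ u₂ v₂ m₂ step2)
    rw [pairSumC_const_mul, pairSumC_finset_sum]
    refine mul_nonneg (by norm_num) (Finset.sum_nonneg fun j _ => ?_)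
    rw [pairSumC_const_mul]
    exact mul_nonneg (Nat.cast_nonneg _)
      (pairSumC_bterm2_nonneg E₁ C₁ E₂ C₂ u₁ v₁ m₁ u₂ v₂ m₂ (prods.get j) N (hval _ (List.get_mem prods j)))
  have hDn' : (0 : ℤ) < Dn := by exact_mod_cast hDn
  nlinarith

/-- **THE PRODUCT-CONE THEOREM FOR TWO-PIECE SHAPES WITH CONTRACTED SKELETON EDGES** via the direct check `FK.certCheck2S`.
[cite: AyyerLinussonRavichandran2025, §7 (p. 22)] -/
theorem shape2KC_nonneg_of_cert (hinj : Function.Injective p)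
    (hE1 : ∀ e ∈ (↑(E₁ ∪ C₁) : Set (Sym2 V)), ∀ z ∈ e, z ∈ V₁) (hE2 : ∀ e ∈ (↑(E₂ ∪ C₂) : Set (Sym2 V)), ∀ z ∈ e, z ∈ V₂)
    (hp1 : ∀ a, p a ∈ V₁ → p a = u₁ ∨ p a = v₁ ∨ p a = m₁) (hp2 : ∀ a, p a ∈ V₂ → p a = u₂ ∨ p a = v₂ ∨ p a = m₂)
    (h12 : ∀ z ∈ V₁, z ∈ V₂ → z = u₂ ∨ z = v₂) (hm1 : m₁ ∈ V₁) (hm2 : m₂ ∈ V₂) (huv1 : u₁ ≠ v₁) (huv2 : u₂ ≠ v₂)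
    (hi1 : p i1 = u₁) (hj1 : p j1 = v₁) (hk1 : p k1 = m₁) (hi2 : p i2 = u₂) (hj2 : p j2 = v₂) (hk2 : p k2 = m₂)
    (hk1' : k1 ≠ i1 ∧ k1 ≠ j1) (hk2' : k2 ≠ i2 ∧ k2 ≠ j2) (hx : p ix = x) (hy : p iy = y) (hs : p is = s)
    (hL : ∀ e ∈ L, p e.1 ≠ p e.2) (hnd : (L.map (pedge p)).Nodup)
    (hLm : ∀ e ∈ L, (p e.1 ≠ m₁ ∧ p e.2 ≠ m₁) ∧ (p e.1 ≠ m₂ ∧ p e.2 ≠ m₂))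
    (hKm : ∀ e ∈ K, (p e.1 ≠ m₁ ∧ p e.2 ≠ m₁) ∧ (p e.1 ≠ m₂ ∧ p e.2 ≠ m₂))
    (hd1 : Disjoint (plainSet p L) E₁) (hd2 : Disjoint (plainSet p L ∪ E₁) E₂) (F : ℕ → Pat3 → Pat3 → ℤ)
    {prods : List Prod2} {Dn B : ℕ} (hDn : 0 < Dn) (hB : 2 * L.length + 2 * K.length + 2 ≤ B)
    (hc : certCheck2S (coefTab2K L K i1 j1 k1 i2 j2 k2 ix iy is F) prods Dn B = true)
    (hval : ∀ q ∈ prods, ∀ ν : ℕ, 0 ≤ lev2C E₁ C₁ u₁ v₁ m₁ q.g1 ν ∧ 0 ≤ lev2C E₂ C₂ u₂ v₂ m₂ q.g2 ν) (μ : ℕ) :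
    0 ≤ lev2C (plainSet p L ∪ E₁ ∪ E₂) (plainSet p K ∪ C₁ ∪ C₂) x y s F μ :=
  shape2KC_nonneg_of_rows hinj hE1 hE2 hp1 hp2 h12 hm1 hm2 huv1 huv2 hi1 hj1 hk1 hi2 hj2 hk2 hk1' hk2' hx hy hs hL hnd hLm hKm
    hd1 hd2 F hDn (certCheck2S_specK hB hc) hval μ

end ShapeTwoK

end FK

end Summit.CriticalPhenomena.PercolationContinuityZ3.Theorems
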